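import Mathlib
import Summits.Schanuel.Schanuel.Theses.RigidCore
import Literature.NumberTheory.Transcendental.ZilberField
import Literature.NumberTheory.Transcendental.KirbyEDerivations
import Literature.NumberTheory.Transcendental.AxSchanuel

/-!
# Sketch — crux stmt-Schanuel-0970 (`RigidCore.SchanuelOnLogFreeCore`), idea `real-leaf-genericity`

First-lemma signatures only (planner, crux-ideate round 1, ideator 1). Nothing is proved here;
the point is that every statement elaborates over existing declarations.
-/

noncomputable section

open FirstOrder
open Literature.NumberTheory.Transcendental
open Literature.ModelTheory.ExponentialFields

namespace Summit.Schanuel.Schanuel.Cruxes.SchanuelOnLogFreeCore.RealLeafGenericity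

/-- The log-free core `C_EA` exactly as inlined in the route decl. -/
def core : IntermediateField ℚ ℂ :=
  sInf {K : IntermediateField ℚ ℂ | (2 * ↑Real.pi * Complex.I : ℂ) ∈ K ∧
    (∀ w ∈ K, Complex.exp w ∈ K) ∧ ∀ w : ℂ, IsAlgebraic K w → w ∈ K}

/-- Sanity: the crux is literally SC on `core`. -/
example : Summit.Schanuel.Schanuel.Theses.RigidCore.SchanuelOnLogFreeCore ↔
    ∀ (n : ℕ) (x : Fin n → ℂ), (∀ i, x i ∈ core) → LinearIndependent ℚ x →
      (n : Cardinal) ≤ Algebra.trdeg ℚ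
        ↥(IntermediateField.adjoin ℚ (Set.range x ∪ Set.range (Complex.exp ∘ x))) :=
  Iff.rfl

/-! ## The hypothesis H_π in three equivalent-in-print forms -/

/-- (H_π, Khovanskii form) `π` is not a real exponential-algebraic number: not a coordinate of a
non-degenerate zero of a real exponential-polynomial system over `ℤ` (tree `ecl` for the real
exponential field `Real.instExponentialRing`). -/
def PiNotRealExpAlgebraic : Prop := Real.pi ∉ ecl (∅ : Set ℝ)

/-- (H_π, model-theoretic form; Bianconi 2005: implied by SC) `{π}` is not `∅`-definable in the
real ordered exponential field. By Wilkie + Jones–Wilkie / Kirby 2010 Thm 1.1 this is equivalent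
to the Khovanskii form. -/
def PiNotRealExpDefinable : Prop :=
  ¬ Set.Definable₁ (∅ : Set ℝ) Language.orderedExpRing ({Real.pi} : Set ℝ)

/-- (H_π, derivation form; Kirby 2010 Thm 1.1 `ecl = cl`: equivalent to the Khovanskii form)
some exponential derivation of the REAL exponential field moves `π`. Every E-derivation of `ℂ_exp`
kills `π` (kernel!), so this is exactly what the complex structure cannot supply. -/
def ExistsRealEDerivationMovingPi : Prop :=
  ∃ D : Derivation ℤ ℝ ℝ, IsEDerivation D ∧ D Real.pi ≠ 0

/-! ## First lemma (the lever at work; provable now from `ax_schanuel_holds` + Hermite) -/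

/-- FIRST LEMMA. An E-derivation of `ℝ_exp` moving `π` makes `π, e^π, e^{π²}` algebraically
independent over its constants (Ax 1971 Thm 3 with `y = (π, π²)`, rank term `= 1`), and the
constants contain `e = exp 1`; with Hermite (`e` transcendental) the four numbers are independent.
Instances of the crux obtained: `(1, πi)` (e ⊥ π), `(πi, π²)` (π ⊥ e^{π²}), `(π, π²)`, `(1, π, π²)`. -/
def FirstLemma : Prop :=
  ExistsRealEDerivationMovingPi →
    AlgebraicIndependent ℚ ![Real.exp 1, Real.pi, Real.exp Real.pi, Real.exp (Real.pi ^ 2)]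

/-- The same over the full constant field, all ranks along the polynomial tower in `π`
(Edmundo–Terzo 2008 Thm 3.5 / 4.1 pattern): for an E-derivation `D` moving `π`,
`trdeg_{C_D} C_D(π, π², …, πⁿ, e^{π}, …, e^{πⁿ}) ≥ n + 1`, `C_D` = constants of `D` (∋ e, e^e, …). -/
def TowerPlusOne : Prop :=
  ∀ (D : Derivation ℤ ℝ ℝ), IsEDerivation D → D Real.pi ≠ 0 → ∀ n : ℕ,
    ((n + 1 : ℕ) : Cardinal) ≤ Algebra.trdeg (constantSubring ![D])
      (Algebra.adjoin (constantSubring ![D])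
        (Set.range (fun k : Fin n => Real.pi ^ (k.val + 1)) ∪
         Set.range (fun k : Fin n => Real.exp (Real.pi ^ (k.val + 1)))))

/-! ## Mirror lemma (circle leaf): an `SO₂`-derivation moving `e` -/

/-- Circle-leaf mirror: a derivation of `ℝ` respecting `cos`/`sin` (the circle exponential
`b ↦ e^{ib}`; its kernel `2πℤ` forces `D π = 0`) and moving `e` gives `π, e, cos e`
algebraically independent (Ax over `ℂ = ℝ(i)` with `D i = 0`, `y = (ie)`). Covers the crux
instances `(1, πi)` again and `(1, ie)`-type statements. -/
def MirrorLemma : Prop :=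
  (∃ D : Derivation ℤ ℝ ℝ, (∀ b : ℝ, D (Real.cos b) = -Real.sin b * D b ∧
      D (Real.sin b) = Real.cos b * D b) ∧ D (Real.exp 1) ≠ 0) →
    AlgebraicIndependent ℚ ![Real.pi, Real.exp 1, Real.cos (Real.exp 1)]

/-! ## The sector of the crux reached (stated; its proof = E–T Thm 3.5 + splitting) -/

/-- The real-exponential prime model `P = dcl^{ℝ_exp}(∅)` (real Khovanskii numbers:
`e, e^e, √2, e^{√2}, log 2, Ω, …`; conjecturally `∌ π`). -/
def realExpPrime : Set ℝ := {a | Set.Definable₁ (∅ : Set ℝ) Language.orderedExpRing ({a} : Set ℝ)}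

/-- Numbers real-exponentially definable from `π` (`π, e^π, e^{π²}, π + e, …`). -/
def realExpDclPi : Set ℝ :=
  {a | Set.Definable₁ ({Real.pi} : Set ℝ) Language.orderedExpRing ({a} : Set ℝ)}

/-- RESIDUE R1 (Macintyre–Wilkie sector): Schanuel for real tuples of the core lying in the
real-exponential prime model (π-free real towers: `(1, e)`, `(1, e, e²)`, `(√2, e^{√2})`, …).
Untouched by the lever; named so that the sector theorem is honest. -/
def MacintyreSector : Prop :=
  ∀ (n : ℕ) (a : Fin n → ℝ), (∀ i, a i ∈ realExpPrime) → (∀ i, (a i : ℂ) ∈ core) →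
    LinearIndependent ℚ a →
      (n : Cardinal) ≤ Algebra.trdeg ℚ
        ↥(IntermediateField.adjoin ℚ (Set.range (fun i => (a i : ℂ)) ∪
          Set.range (fun i => Complex.exp (a i : ℂ))))

/-- SECTOR THEOREM (target of the line): `H_π ∧ MacintyreSector ⟹` the crux for every core tuple
whose entries lie in `dcl^{ℝ_exp}(π) ⊕ ℚ·πi` (the exp-leaf sector: contains `(1, πi)`, `(πi, π²)`,
`(π√2, π)`, all real π-towers, `(1, e)`, …; excludes the kernel-direction cells `(πi, πi√2)`,
`(i, πi)`). -/
def ExpLeafSector : Prop :=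
  PiNotRealExpDefinable → MacintyreSector →
    ∀ (n : ℕ) (a : Fin n → ℝ) (q : Fin n → ℚ), (∀ i, a i ∈ realExpDclPi) →
      (∀ i, ((a i : ℂ) + (q i : ℂ) * (↑Real.pi * Complex.I)) ∈ core) →
      LinearIndependent ℚ (fun i => (a i : ℂ) + (q i : ℂ) * (↑Real.pi * Complex.I)) →
        (n : Cardinal) ≤ Algebra.trdeg ℚ
          ↥(IntermediateField.adjoin ℚ
            (Set.range (fun i => (a i : ℂ) + (q i : ℂ) * (↑Real.pi * Complex.I)) ∪
             Set.range (fun i => Complex.exp ((a i : ℂ) + (q i : ℂ) * (↑Real.pi * Complex.I)))))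

/-- The rung structure of H_π: rung 1 (one-variable real Khovanskii systems) is EXACTLY
Nesterenko's theorem `π ⊥ e^π`; stated here as the target it discharges. -/
def HPiRungOne : Prop :=
  ∀ F : MvPolynomial (Fin 2) ℤ, F ≠ 0 → MvPolynomial.aeval ![Real.pi, Real.exp Real.pi] F ≠ 0

/-- Rung 2 of H_π as a one-parameter family of rank-3 instances through Nesterenko's pair
(contains e ⊥ π ⊥ e^π at t = 1, two-moduli Nesterenko at t = π√2, e^π ⊥ e^{π²} at t = π²). -/
def HPiRungTwoFamily : Prop :=
  ∀ t : ℝ, LinearIndependent ℚ ![Real.pi, t] →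
    (3 : Cardinal) ≤ Algebra.trdeg ℚ
      ↥(IntermediateField.adjoin ℚ ({Real.pi, t, Real.exp Real.pi, Real.exp t} : Set ℝ))

end Summit.Schanuel.Schanuel.Cruxes.SchanuelOnLogFreeCore.RealLeafGenericity

end
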